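import Summits.BirchSwinnertonDyer.BirchSwinnertonDyer.Theorems.ByReductionTypeAtTwoSupersingularFlatBlindTwistSideDictionary
import HarnessLib

/-!
# The twist dictionary at `p = 2`, II: the intertwining isomorphism `φ_J : W₂[2^J] ≅ E[2^J](χ₋₁)` and the
# Kummer image of `W₂(ℚ_v)` inside the Kummer line of the `ψ₂`-vectors (hand HT-2 of crux
# `SupersingularRankZeroAtTwo`, line `odd_blind_package`, slot 5 / CDF_glob)

Cell `bsd-2adic` (run/shared/lean/pub/bsd-2adic/), seat `bsd-2adic-tower-1` GEN 58, `--supports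
stmt-BirchSwinnertonDyer-19097` (helper). HONEST FRAMING: THEOREMS ONLY (no `def`, no named fact, no instance,
no `sorry`); nothing is booked; `SupersingularRankZeroAtTwo`, CDF_glob and BSD are NOT proved by any of this.
Continuation of `…FlatBlindTwistSideDictionary.lean` (§1–§3: `ℚ_1 = ℚ(√2)`, parity of the twist exponent, generic
transport of local Kummer classes).

## What

* §4 the twist map on points `g = e_θ ∘ (model iso)⁻¹ : W₂(ℚ̄) ≃+ W(ℚ̄)` (`twistPointsIso`, `twistGeomPointsEquiv` at
  a square root `θ ∈ ℚ_1` of `2`) and its local companion `g_E : W₂(ℚ̄_E) ≃+ W(ℚ̄_E)` at `θ_E = ι θ`: sign rules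
  (`g(σP) = ±σ g(P)` as `σθ = ±θ`) and the local square `pointsMap ∘ g = g_E ∘ pointsMap`;
* §5 **`exists_intertwining_twist`**: for a cyclotomic `ℤ₂`-extension `κ` of `ℚ` and a model `W₂` of `W^{(2)}`,
  mutually inverse `Γ_ℚ`-intertwining maps `φ_J : W₂[2^J] ⇄ M_J = W.twistedTorsionGaloisModule 2 κ J (-1) two_dvd_neg_one_sub_one : ψ_J`
  (the sign `(−1)^{κ(σ) mod 2^J}` IS `±` according as `σ ∈ κ⁻¹(2ℤ₂) = Gal(ℚ̄/ℚ(√2))`), such that at a completion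
  `ℚ_v` with local topological generator `g`, **`H¹(φ_J|_{ℚ_v})` maps the local Kummer condition of `W₂` INTO the
  Kummer line `K_J = W.twistedTorsionLocalKummer 2 κ J (-1) two_dvd_neg_one_sub_one ℚ_v A_ψ`**, `A_ψ = E(ℚ_{1,v}) ∩ ker (g + 1)` (the
  image `g_E(x)` of `x ∈ W₂(ℚ_v)` is fixed by `Gal(ℚ̄_v/ℚ_{1,v})` and negated by `g`).

Consumer (same seat): the hand `HT2_exists_bound_strict_mul_relindex`, which transports the three Selmer structures of
the hand along `φ_J` to Selmer structures on `W₂[2^J]` (the Kummer condition of `W₂` at `2` then sits INSIDE the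
transported Kummer line, which is all the index bound needs).

References: [GreenbergLNM1716] §4 pp. 105–107, 122–124; [SilvermanAEC2009] X.2 Prop. 2.4, X.5 Cor. 5.4, VIII.§2,
X.§4; [Washington1997] §13.1; [Kobayashi2003] Def. 1.1.
-/

set_option autoImplicit false
set_option linter.dupNamespace false

noncomputable section

open scoped Classical

universe u

namespace Summit.BirchSwinnertonDyer.BirchSwinnertonDyer.Theorems.FlatBlindTwistSide

open Field NumberField IsDedekindDomain WeierstrassCurve CategoryTheory
open Literature.NumberTheory.EllipticCurves Literature.NumberTheory.GaloisRepresentations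
  Literature.NumberTheory.EllipticCurves.ZpExtension Literature.NumberTheory.EllipticCurves.Kobayashi2003
open scoped ContRepresentation
open Summit.BirchSwinnertonDyer.BirchSwinnertonDyer.Theorems.OddBlindTwist (two_dvd_neg_one_sub_one)

/-! ## §4 The twist isomorphism on points: signs, and the local square -/

section Points

variable (W : WeierstrassCurve ℚ) (W₂ : WeierstrassCurve ℚ) {C : VariableChange ℚ}
  (hC : C • W.quadraticTwist 2 = W₂) {C₁ : VariableChange ℚ} (hC₁ : C₁ • W = W.quadraticTwist 1)
  {θ : AlgebraicClosure ℚ} (hθ : θ ^ 2 = algebraMap ℚ (AlgebraicClosure ℚ) 2)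

/-- `g = e_θ ∘ (model iso)⁻¹ : W₂(ℚ̄) ≃+ W(ℚ̄)` commutes with `σ` when `σθ = θ`. [cite: SilvermanAEC2009, X.5 Cor. 5.4] -/
theorem twistMap_smul_of_eq (σ : absoluteGaloisGroup ℚ) (hσ : σ • θ = θ) (P : W₂.geomPoints) :
    ((twistPointsIso hC).symm.trans (W.twistGeomPointsEquiv hC₁ two_ne_zero hθ)) (σ • P) =
      σ • ((twistPointsIso hC).symm.trans (W.twistGeomPointsEquiv hC₁ two_ne_zero hθ)) P := by
  have h1 : (twistPointsIso hC).symm (σ • P) = σ • (twistPointsIso hC).symm P := by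
    apply (twistPointsIso hC).injective
    rw [AddEquiv.apply_symm_apply, twistPointsIso_smul, AddEquiv.apply_symm_apply]
  rw [AddEquiv.trans_apply, AddEquiv.trans_apply, h1, W.twistGeomPointsEquiv_smul_of_eq hC₁ two_ne_zero hθ σ hσ]

/-- `g` anti-commutes with `σ` when `σθ = −θ`: `g(σP) = −σ g(P)`. [cite: SilvermanAEC2009, X.2 Prop. 2.4] -/
theorem twistMap_smul_of_eq_neg (σ : absoluteGaloisGroup ℚ) (hσ : σ • θ = -θ) (P : W₂.geomPoints) :
    ((twistPointsIso hC).symm.trans (W.twistGeomPointsEquiv hC₁ two_ne_zero hθ)) (σ • P) =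
      -(σ • ((twistPointsIso hC).symm.trans (W.twistGeomPointsEquiv hC₁ two_ne_zero hθ)) P) := by
  have h1 : (twistPointsIso hC).symm (σ • P) = σ • (twistPointsIso hC).symm P := by
    apply (twistPointsIso hC).injective
    rw [AddEquiv.apply_symm_apply, twistPointsIso_smul, AddEquiv.apply_symm_apply]
  rw [AddEquiv.trans_apply, AddEquiv.trans_apply, h1,
    W.twistGeomPointsEquiv_smul_of_eq_neg hC₁ two_ne_zero hθ σ hσ]

variable (E : Type) [Field E] [Algebra ℚ E]

include hθ in
/-- The image `θ_E` of `θ` in `ℚ̄_E` is a square root of `2`. [folklore] -/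
theorem closureEmb_sq_eq : (closureEmb (K := ℚ) E θ) ^ 2 = algebraMap ℚ (AlgebraicClosure E) 2 := by
  rw [← map_pow, hθ, map_ofNat (algebraMap ℚ (AlgebraicClosure ℚ)) 2, map_ofNat, map_ofNat]

/-- **The local square**: `pointsMap_W ∘ g = g_E ∘ pointsMap_{W₂}` for the local twist map
`g_E = e_{θ_E} ∘ (model iso)⁻¹ : W₂(ℚ̄_E) ≃+ W(ℚ̄_E)`. [cite: SilvermanAEC2009, VIII.§1 and X.§4] -/
theorem pointsMap_twistMap (P : W₂.geomPoints) :
    pointsMap W E (((twistPointsIso hC).symm.trans (W.twistGeomPointsEquiv hC₁ two_ne_zero hθ)) P) =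
      ((twistLocalIso E hC).symm.trans
        (W.twistLocalPointsEquiv hC₁ two_ne_zero E (closureEmb_sq_eq hθ E))) (pointsMap W₂ E P) := by
  rw [AddEquiv.trans_apply, AddEquiv.trans_apply]
  have h1 : pointsMap (W.quadraticTwist 2) E ((twistPointsIso hC).symm P) =
      (twistLocalIso E hC).symm (pointsMap W₂ E P) := by
    apply (twistLocalIso E hC).injective
    rw [AddEquiv.apply_symm_apply, ← pointsMap_twistPointsIso E hC, AddEquiv.apply_symm_apply]
  rw [← h1]
  exact W.pointsMapOfEmb_twistGeomPointsEquiv hC₁ two_ne_zero hθ (closureEmb (K := ℚ) E)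
    (closureEmb_sq_eq hθ E) rfl _

/-- `g_E` commutes with `τ ∈ Γ_E` when `τ θ_E = θ_E`. [cite: SilvermanAEC2009, X.5 Cor. 5.4] -/
theorem twistLocalMap_smul_of_eq (τ : absoluteGaloisGroup E) (hτ : τ • closureEmb (K := ℚ) E θ = closureEmb (K := ℚ) E θ)
    (Q : localPoints W₂ E) :
    ((twistLocalIso E hC).symm.trans (W.twistLocalPointsEquiv hC₁ two_ne_zero E (closureEmb_sq_eq hθ E))) (τ • Q) =
      τ • ((twistLocalIso E hC).symm.trans
        (W.twistLocalPointsEquiv hC₁ two_ne_zero E (closureEmb_sq_eq hθ E))) Q := by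
  have h1 : (twistLocalIso E hC).symm (τ • Q) = τ • (twistLocalIso E hC).symm Q := by
    apply (twistLocalIso E hC).injective
    rw [AddEquiv.apply_symm_apply, twistLocalIso_smul, AddEquiv.apply_symm_apply]
  rw [AddEquiv.trans_apply, AddEquiv.trans_apply, h1,
    W.twistLocalPointsEquiv_smul_of_eq hC₁ two_ne_zero (closureEmb_sq_eq hθ E) τ hτ]

/-- `g_E` anti-commutes with `τ ∈ Γ_E` when `τ θ_E = −θ_E`. [cite: SilvermanAEC2009, X.2 Prop. 2.4] -/
theorem twistLocalMap_smul_of_eq_neg (τ : absoluteGaloisGroup E)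
    (hτ : τ • closureEmb (K := ℚ) E θ = -closureEmb (K := ℚ) E θ) (Q : localPoints W₂ E) :
    ((twistLocalIso E hC).symm.trans (W.twistLocalPointsEquiv hC₁ two_ne_zero E (closureEmb_sq_eq hθ E))) (τ • Q) =
      -(τ • ((twistLocalIso E hC).symm.trans
        (W.twistLocalPointsEquiv hC₁ two_ne_zero E (closureEmb_sq_eq hθ E))) Q) := by
  have h1 : (twistLocalIso E hC).symm (τ • Q) = τ • (twistLocalIso E hC).symm Q := by
    apply (twistLocalIso E hC).injective
    rw [AddEquiv.apply_symm_apply, twistLocalIso_smul, AddEquiv.apply_symm_apply]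
  rw [AddEquiv.trans_apply, AddEquiv.trans_apply, h1,
    W.twistLocalPointsEquiv_smul_of_eq_neg hC₁ two_ne_zero (closureEmb_sq_eq hθ E) τ hτ]

/-- Along the restriction `Γ_E → Γ_ℚ` attached to the chosen embedding: `τ • θ_E = ι((τ|_{ℚ̄}) • θ)`.
[folklore] -/
theorem smul_closureEmb (τ : absoluteGaloisGroup E) (x : AlgebraicClosure ℚ) :
    τ • closureEmb (K := ℚ) E x = closureEmb (K := ℚ) E (resGal (K := ℚ) E τ • x) :=
  (apply_resGalAuxOfEmb_apply (closureEmb (K := ℚ) E) τ x).symm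

end Points

/-! ## §5 The dictionary `φ_J : W₂[2^J] ≅ E[2^J](χ₋₁)` and the Kummer line at `2` -/

section Dictionary

variable (W : WeierstrassCurve ℚ) (W₂ : WeierstrassCurve ℚ) [W₂.IsElliptic] {κ : ZpExtension ℚ 2}

/-- **The twist dictionary.** For a cyclotomic `ℤ₂`-extension `κ` of `ℚ`, a model `W₂` of the quadratic twist
`W^{(2)}` (`C • W.quadraticTwist 2 = W₂`) and every level `J`, there are mutually inverse `Γ_ℚ`-intertwining
maps `φ : W₂[2^J] ⇄ E[2^J](χ₋₁) : ψ` (underlying map: the twist isomorphism over `ℚ(√2) = ℚ_1`), and at a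
completion `ℚ_v` with a local topological generator `g` of `κ`, `H¹(φ|_{ℚ_v})` carries the local Kummer condition
of `W₂` INTO the Kummer line `W.twistedTorsionLocalKummer 2 κ J (-1) two_dvd_neg_one_sub_one ℚ_v A_ψ` of the `ψ₂`-vectors
`A_ψ = E(ℚ_{1,v}) ∩ ker (g + 1)`. [cite: GreenbergLNM1716, §4 pp. 105–107, 124] [cite: SilvermanAEC2009, X.2 Prop. 2.4, X.5 Cor. 5.4, X.§4] -/
theorem exists_intertwining_twist (hκ : κ.IsCyclotomic) (htw : ∃ C : VariableChange ℚ, C • W.quadraticTwist 2 = W₂)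
    (v : HeightOneSpectrum (𝓞 ℚ)) {g : absoluteGaloisGroup (v.adicCompletion ℚ)}
    (hg : κ.IsTopGenerator (resGalOfEmb (closureEmb (K := ℚ) (v.adicCompletion ℚ)) g)) (J : ℕ) :
    ∃ (φ : (W₂.torsionGaloisModule ((2 ^ J : ℕ) : ℤ)).toContRepresentation →ⁱL
        (W.twistedTorsionGaloisModule 2 κ J (-1) two_dvd_neg_one_sub_one).toContRepresentation)
      (ψ : (W.twistedTorsionGaloisModule 2 κ J (-1) two_dvd_neg_one_sub_one).toContRepresentation →ⁱL
        (W₂.torsionGaloisModule ((2 ^ J : ℕ) : ℤ)).toContRepresentation),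
      (∀ a, ψ (φ a) = a) ∧ (∀ b, φ (ψ b) = b) ∧
      (W₂.kummerLocalConditionAt ((2 ^ J : ℕ) : ℤ) (v.adicCompletion ℚ)).map
          (galoisCohomology.map (φ.restrictField (v.adicCompletion ℚ)) 1) ≤
        W.twistedTorsionLocalKummer 2 κ J (-1) two_dvd_neg_one_sub_one (v.adicCompletion ℚ)
          (localLayerPointsOfEmb κ (closureEmb (K := ℚ) (v.adicCompletion ℚ)) W 1 ⊓
            (DistribSMul.toAddMonoidHom (localPoints W (v.adicCompletion ℚ)) g + AddMonoidHom.id _).ker) := by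
  obtain ⟨C, hC⟩ := htw
  obtain ⟨C₁, hC₁⟩ := W.exists_variableChange_quadraticTwist_one
  obtain ⟨θ, hθ, hfix, hneg⟩ := exists_sqrt_two_smul hκ
  set E := v.adicCompletion ℚ with hE
  -- the global and local twist maps
  set gm : W₂.geomPoints ≃+ W.geomPoints :=
    (twistPointsIso hC).symm.trans (W.twistGeomPointsEquiv hC₁ two_ne_zero hθ) with hgm
  set gE : localPoints W₂ E ≃+ localPoints W E :=
    (twistLocalIso E hC).symm.trans (W.twistLocalPointsEquiv hC₁ two_ne_zero E (closureEmb_sq_eq hθ E)) with hgE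
  set n : ℤ := ((2 ^ J : ℕ) : ℤ) with hn
  set e : W₂.geomTorsion n ≃+ W.geomTorsion n := torsionByCongr gm n with he
  -- the sign rule for `gm` against the twist exponent
  have hsign : ∀ (σ : absoluteGaloisGroup ℚ) (T : W₂.geomTorsion n),
      e (σ • T) = ((-1 : ℤ) ^ κ.twistExponent J σ) • (σ • e T) := by
    intro σ T
    apply Subtype.ext
    rw [Literature.NumberTheory.EllipticCurves.coe_torsionByCongr_apply,
      Literature.NumberTheory.EllipticCurves.AddSubgroup.torsionBy.coe_smul, AddSubgroupClass.coe_zsmul,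
      Literature.NumberTheory.EllipticCurves.AddSubgroup.torsionBy.coe_smul,
      Literature.NumberTheory.EllipticCurves.coe_torsionByCongr_apply]
    rcases Nat.eq_zero_or_pos J with hJ0 | hJ
    · -- level `0`: the module is zero
      have hT : (T : W₂.geomPoints) = 0 := by
        have h2 : n • (T : W₂.geomPoints) = 0 := (Submodule.mem_torsionBy_iff _ _).mp T.2
        have hn1 : n = 1 := by rw [hn, hJ0, pow_zero, Nat.cast_one]
        have key : ∀ (m : ℤ) (P : W₂.geomPoints), m = 1 → m • P = 0 → P = 0 := by
          rintro m P rfl h; rwa [one_smul] at h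
        exact key n _ hn1 h2
      rw [hT, smul_zero, map_zero, smul_zero, smul_zero]
    · rw [neg_one_pow_twistExponent_smul κ hJ σ]
      by_cases hσ : σ ∈ κ.layerSubgroup 1
      · rw [if_pos hσ, twistMap_smul_of_eq W W₂ hC hC₁ hθ σ (hfix σ hσ)]
      · rw [if_neg hσ, twistMap_smul_of_eq_neg W W₂ hC hC₁ hθ σ (hneg σ hσ)]
  -- the intertwining maps
  let φ : (W₂.torsionGaloisModule n).toContRepresentation →ⁱL
      (W.twistedTorsionGaloisModule 2 κ J (-1) two_dvd_neg_one_sub_one).toContRepresentation :=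
    { toContinuousLinearMap := ⟨e.toAddMonoidHom.toIntLinearMap, continuous_of_discreteTopology⟩
      isIntertwining' := fun σ ↦ by
        refine ContinuousLinearMap.ext fun T ↦ ?_
        change e (W₂.torsionGaloisModule n σ T) = W.twistedTorsionGaloisModule 2 κ J (-1) two_dvd_neg_one_sub_one σ (e T)
        rw [ZpExtension.galoisTwist_apply_apply, torsionGaloisModule_apply_apply, torsionGaloisModule_apply_apply]
        exact hsign σ T }
  let ψ : (W.twistedTorsionGaloisModule 2 κ J (-1) two_dvd_neg_one_sub_one).toContRepresentation →ⁱL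
      (W₂.torsionGaloisModule n).toContRepresentation :=
    { toContinuousLinearMap := ⟨e.symm.toAddMonoidHom.toIntLinearMap, continuous_of_discreteTopology⟩
      isIntertwining' := fun σ ↦ by
        refine ContinuousLinearMap.ext fun S ↦ ?_
        change e.symm (W.twistedTorsionGaloisModule 2 κ J (-1) two_dvd_neg_one_sub_one σ S) = W₂.torsionGaloisModule n σ (e.symm S)
        apply e.injective
        rw [AddEquiv.apply_symm_apply, ZpExtension.galoisTwist_apply_apply, torsionGaloisModule_apply_apply,
          torsionGaloisModule_apply_apply, hsign, AddEquiv.apply_symm_apply] }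
  refine ⟨φ, ψ, fun a ↦ e.symm_apply_apply a, fun b ↦ e.apply_symm_apply b, ?_⟩
  -- the local Kummer condition lands in the Kummer line of the `ψ₂`-vectors
  have hsq : ∀ P : W₂.geomPoints, pointsMap W E (gm P) = gE (pointsMap W₂ E P) :=
    fun P ↦ pointsMap_twistMap W W₂ hC hC₁ hθ E P
  -- `τ ∈ Γ_E` with `τ|_{ℚ̄} ∈ κ⁻¹(2ℤ₂)` fixes `θ_E`; the local generator negates it
  have hθE_fix : ∀ τ : absoluteGaloisGroup E, resGal (K := ℚ) E τ ∈ κ.layerSubgroup 1 →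
      τ • closureEmb (K := ℚ) E θ = closureEmb (K := ℚ) E θ := fun τ hτ ↦ by
    rw [smul_closureEmb, hfix _ hτ]
  have hθE_neg : ∀ τ : absoluteGaloisGroup E, resGal (K := ℚ) E τ ∉ κ.layerSubgroup 1 →
      τ • closureEmb (K := ℚ) E θ = -closureEmb (K := ℚ) E θ := fun τ hτ ↦ by
    rw [smul_closureEmb, hneg _ hτ, map_neg]
  have hgEeq : ∀ τ : absoluteGaloisGroup E, τ ∈ localSubgroup κ.kerSubgroup E →
      ∀ Q : localPoints W₂ E, gE (τ • Q) = τ • gE Q := fun τ hτ Q ↦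
    twistLocalMap_smul_of_eq W W₂ hC hC₁ hθ E τ
      (hθE_fix τ (κ.kerSubgroup_le_layerSubgroup 1 ((mem_localSubgroup_iff _ E τ).mp hτ))) Q
  have hφ : ∀ T : W₂.geomTorsion n, ((φ T : W.geomTorsion n) : W.geomPoints) = gm (T : W₂.geomPoints) :=
    fun T ↦ rfl
  refine map_kummerLocalConditionAt_le_twistedTorsionLocalKummer W W₂ 2 κ J (-1) two_dvd_neg_one_sub_one E gm gE hsq hgEeq φ hφ _
    fun Q hQ ↦ ⟨J, ?_⟩
  -- the point `x = 2^J Q ∈ W₂(ℚ_v)` and its image `gE x`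
  have hx : 2 ^ J • gE Q = gE ((((2 ^ J : ℕ) : ℤ)) • Q) := by
    rw [← map_nsmul, ← natCast_zsmul, Nat.cast_pow, Nat.cast_ofNat]
  have hQfix : ∀ τ : absoluteGaloisGroup E, τ • ((((2 ^ J : ℕ) : ℤ)) • Q) = (((2 ^ J : ℕ) : ℤ)) • Q :=
    fun τ ↦ hQ τ
  rw [hx]
  refine AddSubgroup.mem_inf.mpr ⟨?_, ?_⟩
  · -- fixed by `Gal(ℚ̄_v/ℚ_{1,v})`
    rw [mem_localLayerPointsOfEmb_iff]
    intro τ hτ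
    have hτ' : resGal (K := ℚ) E τ ∈ κ.layerSubgroup 1 := by
      rw [ZpExtension.mem_layerSubgroup]
      exact (mem_localLayerSubgroupOfEmb_iff κ _ 1 τ).mp hτ
    rw [← twistLocalMap_smul_of_eq W W₂ hC hC₁ hθ E τ (hθE_fix τ hτ') _, hQfix τ]
  · -- negated by the local topological generator `g`
    have hg' : resGal (K := ℚ) E g ∉ κ.layerSubgroup 1 := by
      rw [ZpExtension.mem_layerSubgroup, pow_one]
      have h1 : κ (resGal (K := ℚ) E g) = Multiplicative.ofAdd 1 := hg
      rw [h1, toAdd_ofAdd]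
      intro hdvd
      exact (PadicInt.irreducible_p (p := 2)).not_isUnit (isUnit_of_dvd_one hdvd)
    rw [AddMonoidHom.mem_ker, AddMonoidHom.add_apply, AddMonoidHom.id_apply, DistribSMul.toAddMonoidHom_apply]
    have h := twistLocalMap_smul_of_eq_neg W W₂ hC hC₁ hθ E g (hθE_neg g hg') ((((2 ^ J : ℕ) : ℤ)) • Q)
    rw [hQfix g] at h
    -- `gE x = -(g • gE x)`
    have h' : g • gE ((((2 ^ J : ℕ) : ℤ)) • Q) + gE ((((2 ^ J : ℕ) : ℤ)) • Q) =
        g • gE ((((2 ^ J : ℕ) : ℤ)) • Q) + -(g • gE ((((2 ^ J : ℕ) : ℤ)) • Q)) :=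
      congrArg (fun y ↦ g • gE ((((2 ^ J : ℕ) : ℤ)) • Q) + y) h
    rw [h', add_neg_cancel]

end Dictionary

end Summit.BirchSwinnertonDyer.BirchSwinnertonDyer.Theorems.FlatBlindTwistSide

end
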